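import Summits.CriticalPhenomena.PercolationContinuityZ3.Theorems.PercNearOneGluingNoHeavyLowerTailMajorityGluingZThirteenEightP37
import Summits.CriticalPhenomena.PercolationContinuityZ3.Theorems.PercNearOneGluingNoHeavyLowerTailMajorityGluingZThirteenEightP38
import Summits.CriticalPhenomena.PercolationContinuityZ3.Theorems.PercNearOneGluingNoHeavyLowerTailMajorityGluingZThirteenEightP39
import Summits.CriticalPhenomena.PercolationContinuityZ3.Theorems.PercNearOneGluingNoHeavyLowerTailMajorityGluingZThirteenEightP40
import Summits.CriticalPhenomena.PercolationContinuityZ3.Theorems.PercNearOneGluingNoHeavyLowerTailMajorityGluingZThirteenEightP41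
import Summits.CriticalPhenomena.PercolationContinuityZ3.Theorems.PercNearOneGluingNoHeavyLowerTailMajorityGluingZThirteenEightP42
import Summits.CriticalPhenomena.PercolationContinuityZ3.Theorems.PercNearOneGluingNoHeavyLowerTailMajorityGluingZThirteenEightP43
import Summits.CriticalPhenomena.PercolationContinuityZ3.Theorems.PercNearOneGluingNoHeavyLowerTailMajorityGluingZThirteenEightHG4C1
import Summits.CriticalPhenomena.PercolationContinuityZ3.Theorems.PercNearOneGluingNoHeavyLowerTailMajorityGluingZThirteenEightHG4C2
import Summits.CriticalPhenomena.PercolationContinuityZ3.Theorems.PercNearOneGluingNoHeavyLowerTailMajorityGluingZThirteenEightHG4C3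
import Summits.CriticalPhenomena.PercolationContinuityZ3.Theorems.PercNearOneGluingNoHeavyLowerTailMajorityGluingZThirteenEightHG4C4
import Summits.CriticalPhenomena.PercolationContinuityZ3.Theorems.PercNearOneGluingNoHeavyLowerTailMajorityGluingZThirteenEightHG4C5
import Summits.CriticalPhenomena.PercolationContinuityZ3.Theorems.PercNearOneGluingNoHeavyLowerTailMajorityGluingZThirteenEightHG4C6
import Summits.CriticalPhenomena.PercolationContinuityZ3.Theorems.PercNearOneGluingNoHeavyLowerTailMajorityGluingZRangeAM
import HarnessLib

/-!
# Group 4 of 4 of the `(13,8)` certificate at `c = 11/8`: its aggregate-merge tree IS the concatenation of its 6 key-range chunks (lane prim-rate, constants-miner 1, gen 39; cert/mkhier.py)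

Support file for the closed crux `NoHeavyLowerTail` (stmt-CriticalPhenomena-4575), majority-gluing line.  The 7 parts P37, P38, P39, P40, P41, P42, P43 (kit j311929) carry verified
type-space digests `…D`; `thirteenEightT2G4T` is their binary tree of aggregated merges (`am`, …MajorityGluingZRangeAM, depth 3); the kernel verifies `thirteenEightT2G4T = [chunks].flatten`
(`thirteenEightT2G4_eq`), and `thirteenEightT2G4_val` identifies the value of the group's digests with the value of its chunks (`evalC_am`).  No sorries. [cite: VandenbergKahn2001, Thm 1.2 (p. 123)]
-/

namespace Summit.CriticalPhenomena.PercolationContinuityZ3.Theorems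

namespace HubOnly
namespace QCert

/-- The aggregate-merge tree of group 4. -/
def thirteenEightT2G4T : List (ℕ × ℤ) :=
  am (am (am (thirteenEightTP37D) (thirteenEightTP38D)) (am (thirteenEightTP39D) (thirteenEightTP40D))) (am (am (thirteenEightTP41D) (thirteenEightTP42D)) (thirteenEightTP43D))

set_option maxRecDepth 8192 in
set_option maxHeartbeats 0 in
/-- **The tree of group 4 equals the concatenation of its key-range chunks** (kernel evaluation). -/
theorem thirteenEightT2G4_eq : thirteenEightT2G4T = [thirteenEightT2G4C1, thirteenEightT2G4C2, thirteenEightT2G4C3, thirteenEightT2G4C4, thirteenEightT2G4C5, thirteenEightT2G4C6].flatten := by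
  decide +kernel

/-- The tree's value is the value of the group's digests. -/
theorem thirteenEightT2G4_treeVal (val : ℕ → ℝ) : evalC val thirteenEightT2G4T = evalC val [thirteenEightTP37D, thirteenEightTP38D, thirteenEightTP39D, thirteenEightTP40D, thirteenEightTP41D, thirteenEightTP42D, thirteenEightTP43D].flatten := by
  simp only [thirteenEightT2G4T, evalC_am, List.flatten_cons, List.flatten_nil, evalC_append, evalC_nil', add_assoc, add_zero]

/-- **The value of group 4's digests is the value of its chunks.** -/
theorem thirteenEightT2G4_val (val : ℕ → ℝ) : evalC val [thirteenEightTP37D, thirteenEightTP38D, thirteenEightTP39D, thirteenEightTP40D, thirteenEightTP41D, thirteenEightTP42D, thirteenEightTP43D].flatten = evalC val [thirteenEightT2G4C1, thirteenEightT2G4C2, thirteenEightT2G4C3, thirteenEightT2G4C4, thirteenEightT2G4C5, thirteenEightT2G4C6].flatten := by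
  rw [← thirteenEightT2G4_treeVal val, thirteenEightT2G4_eq]

end QCert
end HubOnly

end Summit.CriticalPhenomena.PercolationContinuityZ3.Theorems
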